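import Mathlib
import HarnessLib

/-!
# Basic opens `D(s)` of a scheme versus germs in the local rings and primes of affine opens — membership lemmas

`Literature/AlgebraicGeometry/Morphisms/BasicOpenGerms.lean` (namespace `Literature.AlgebraicGeometry.Morphisms`). Everything here
is PROVED (no definition, no named fact): the elementary dictionary between `x ∈ X.basicOpen s` (Mathlib `Scheme.mem_basicOpen`:
`↔ IsUnit (germ s)`), membership of the germ of `s` in the maximal ideal of `𝒪_{X,x}`, powers / sums / differences of sections,
restriction to smaller opens. (On an AFFINE open the prime form `x ∈ D(g) ↔ g ∉ 𝔭_x` is ALREADY public: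
`Literature.AlgebraicGeometry.Resolution.mem_basicOpen_iff_not_mem_primeIdealOf` (`Resolution/BlowupSNC.lean`) /
`…Modules.KernelFiniteLocallyFree.mem_basicOpen_iff_not_mem_primeIdealOf`; the unit-minus-nonunit form is
`Resolution.isUnit_sub_of_mem_maximalIdeal` (`PCyclicBoundaryType.lean` / `HasseSchmidtTower.lean`) — import those.) Written for the HIRONAKA-L lane of the `ResolutionOfSingularities` summit, where these two- to
five-line facts were re-proved PRIVATELY in ≈ 20 files of at least four lineages (`Hironaka2017/Proofs/S10LLChainMod/Thm10p3*`,
`Thm10p4*`, `Thm10p5*`, `Proofs/S16Proof/ChainLink*`, `CuspStrictTransformVy`, `InvSlotSingCuspChartY`; census res-D-lib-2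
2026-08-27T09:45Z); new files import this module instead. Germs of restrictions are Mathlib's `TopCat.Presheaf.germ_res_apply`.

## References

* [StacksProject] The Stacks project, Tag 01HR (basic opens of a locally ringed space / scheme), Tag 01I1.
-/

noncomputable section

open CategoryTheory TopologicalSpace Opposite IsLocalRing
open _root_.AlgebraicGeometry

universe u

namespace Literature.AlgebraicGeometry.Morphisms

/-! ### 1. Local-ring lemma: `𝔪 ∋ a`, `b` unit ⇒ `a ± b` unit -/

section LocalRing

variable {R : Type*} [CommRing R] [IsLocalRing R] {a b : R}

/-- In a local ring, an element of the maximal ideal minus a unit is a unit. [cite: StacksProject, Tag 01HR] -/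
theorem isUnit_sub_of_mem_maximalIdeal_of_isUnit (ha : a ∈ maximalIdeal R) (hb : IsUnit b) : IsUnit (a - b) := by
  by_contra h
  have h' : a - b ∈ maximalIdeal R := (IsLocalRing.mem_maximalIdeal _).mpr h
  have hb' : b ∈ maximalIdeal R := by simpa using Ideal.sub_mem _ ha h'
  exact (IsLocalRing.mem_maximalIdeal _).mp hb' hb

/-- In a local ring, an element of the maximal ideal plus a unit is a unit. [cite: StacksProject, Tag 01HR] -/
theorem isUnit_add_of_mem_maximalIdeal_of_isUnit (ha : a ∈ maximalIdeal R) (hb : IsUnit b) : IsUnit (a + b) := by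
  simpa using isUnit_sub_of_mem_maximalIdeal_of_isUnit ha hb.neg

end LocalRing

/-! ### 2. `x ∈ D(s)` versus the germ of `s` in `𝔪_x` -/

section Germs

variable {X : Scheme.{u}} {U : X.Opens}

/-- `x ∉ D(s)` ⟹ the germ of `s` at `x` lies in the maximal ideal `𝔪_x`. [cite: StacksProject, Tag 01HR] -/
theorem germ_mem_maximalIdeal_of_not_mem_basicOpen (s : Γ(X, U)) {x : X} (hx : x ∈ U) (h : x ∉ X.basicOpen s) :
    (X.presheaf.germ U x hx).hom s ∈ maximalIdeal (X.presheaf.stalk x) := by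
  rw [IsLocalRing.mem_maximalIdeal, mem_nonunits_iff]
  exact fun hu => h ((X.mem_basicOpen s x hx).mpr hu)

/-- The germ of `s` at `x` lies in `𝔪_x` ⟹ `x ∉ D(s)`. [cite: StacksProject, Tag 01HR] -/
theorem not_mem_basicOpen_of_germ_mem_maximalIdeal (s : Γ(X, U)) {x : X} (hx : x ∈ U)
    (h : (X.presheaf.germ U x hx).hom s ∈ maximalIdeal (X.presheaf.stalk x)) : x ∉ X.basicOpen s := fun hb =>
  (mem_nonunits_iff.mp ((IsLocalRing.mem_maximalIdeal _).mp h)) ((X.mem_basicOpen s x hx).mp hb)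

/-- `x ∉ D(s) ↔ germ_x s ∈ 𝔪_x` (for `x ∈ U`). [cite: StacksProject, Tag 01HR] -/
theorem not_mem_basicOpen_iff_germ_mem_maximalIdeal (s : Γ(X, U)) {x : X} (hx : x ∈ U) :
    x ∉ X.basicOpen s ↔ (X.presheaf.germ U x hx).hom s ∈ maximalIdeal (X.presheaf.stalk x) :=
  ⟨germ_mem_maximalIdeal_of_not_mem_basicOpen s hx, not_mem_basicOpen_of_germ_mem_maximalIdeal s hx⟩

/-- `x ∈ D(s) ⟹ x ∈ D(sⁿ)`. [cite: StacksProject, Tag 01HR] -/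
theorem mem_basicOpen_pow (s : Γ(X, U)) {x : X} (hx : x ∈ U) (h : x ∈ X.basicOpen s) (n : ℕ) :
    x ∈ X.basicOpen (s ^ n) := by
  rw [X.mem_basicOpen (s ^ n) x hx, map_pow]
  exact ((X.mem_basicOpen s x hx).mp h).pow n

/-- `x ∉ D(s) ⟹ x ∉ D(sⁿ)` for `n ≠ 0`. [cite: StacksProject, Tag 01HR] -/
theorem not_mem_basicOpen_pow (s : Γ(X, U)) {x : X} (h : x ∉ X.basicOpen s) {n : ℕ} (hn : n ≠ 0) :
    x ∉ X.basicOpen (s ^ n) := by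
  rwa [X.basicOpen_pow s (Nat.pos_of_ne_zero hn)]

/-- If `y` vanishes at `x` (germ in `𝔪_x`) and `u` does not (`x ∈ D(u)`) then `x ∈ D(y - u)`. [cite: StacksProject, Tag 01HR] -/
theorem mem_basicOpen_sub_of_germ_mem_maximalIdeal_of_mem_basicOpen (y u : Γ(X, U)) {x : X} (hx : x ∈ U)
    (hy : (X.presheaf.germ U x hx).hom y ∈ maximalIdeal (X.presheaf.stalk x)) (hu : x ∈ X.basicOpen u) :
    x ∈ X.basicOpen (y - u) := by
  rw [X.mem_basicOpen (y - u) x hx, map_sub]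
  exact isUnit_sub_of_mem_maximalIdeal_of_isUnit hy ((X.mem_basicOpen u x hx).mp hu)

/-- If `u` does not vanish at `x` and `y` does then `x ∈ D(u - y)`. [cite: StacksProject, Tag 01HR] -/
theorem mem_basicOpen_sub_of_mem_basicOpen_of_germ_mem_maximalIdeal (u y : Γ(X, U)) {x : X} (hx : x ∈ U)
    (hu : x ∈ X.basicOpen u) (hy : (X.presheaf.germ U x hx).hom y ∈ maximalIdeal (X.presheaf.stalk x)) :
    x ∈ X.basicOpen (u - y) := by
  rw [X.mem_basicOpen (u - y) x hx, map_sub, ← IsUnit.neg_iff, neg_sub]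
  exact isUnit_sub_of_mem_maximalIdeal_of_isUnit hy ((X.mem_basicOpen u x hx).mp hu)

/-- If `y` vanishes at `x` and `u` does not then `x ∈ D(y + u)`. [cite: StacksProject, Tag 01HR] -/
theorem mem_basicOpen_add_of_germ_mem_maximalIdeal_of_mem_basicOpen (y u : Γ(X, U)) {x : X} (hx : x ∈ U)
    (hy : (X.presheaf.germ U x hx).hom y ∈ maximalIdeal (X.presheaf.stalk x)) (hu : x ∈ X.basicOpen u) :
    x ∈ X.basicOpen (y + u) := by
  rw [X.mem_basicOpen (y + u) x hx, map_add]
  exact isUnit_add_of_mem_maximalIdeal_of_isUnit hy ((X.mem_basicOpen u x hx).mp hu)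

/-- If `y` and `u` both vanish at `x` then so does `y - u`. [cite: StacksProject, Tag 01HR] -/
theorem not_mem_basicOpen_sub (y u : Γ(X, U)) {x : X} (hx : x ∈ U) (hy : x ∉ X.basicOpen y)
    (hu : x ∉ X.basicOpen u) : x ∉ X.basicOpen (y - u) := by
  apply not_mem_basicOpen_of_germ_mem_maximalIdeal _ hx
  rw [map_sub]
  exact Ideal.sub_mem _ (germ_mem_maximalIdeal_of_not_mem_basicOpen y hx hy)
    (germ_mem_maximalIdeal_of_not_mem_basicOpen u hx hu)

/-- If `y` and `u` both vanish at `x` then so does `y + u`. [cite: StacksProject, Tag 01HR] -/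
theorem not_mem_basicOpen_add (y u : Γ(X, U)) {x : X} (hx : x ∈ U) (hy : x ∉ X.basicOpen y)
    (hu : x ∉ X.basicOpen u) : x ∉ X.basicOpen (y + u) := by
  apply not_mem_basicOpen_of_germ_mem_maximalIdeal _ hx
  rw [map_add]
  exact Ideal.add_mem _ (germ_mem_maximalIdeal_of_not_mem_basicOpen y hx hy)
    (germ_mem_maximalIdeal_of_not_mem_basicOpen u hx hu)

/-- If `y` vanishes at `x` then so does `t * y`. [cite: StacksProject, Tag 01HR] -/
theorem not_mem_basicOpen_mul_left (t y : Γ(X, U)) {x : X} (hy : x ∉ X.basicOpen y) :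
    x ∉ X.basicOpen (t * y) := by
  rw [X.basicOpen_mul]
  exact fun h => hy h.2

/-- If `y` vanishes at `x` then so does `y * t`. [cite: StacksProject, Tag 01HR] -/
theorem not_mem_basicOpen_mul_right (y t : Γ(X, U)) {x : X} (hy : x ∉ X.basicOpen y) :
    x ∉ X.basicOpen (y * t) := by
  rw [X.basicOpen_mul]
  exact fun h => hy h.1

end Germs

/-! ### 3. Restriction to a smaller open -/

section Restrict

variable {X : Scheme.{u}}

/-- Restricting a section to a smaller open does not change its non-vanishing locus inside that open:
`x ∈ D(s|_W) ↔ x ∈ D(s)` for `x ∈ W ≤ V`. [cite: StacksProject, Tag 01HR] -/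
theorem mem_basicOpen_res_iff {W V : X.Opens} (hWV : W ≤ V) {x : X} (hxW : x ∈ W) (s : Γ(X, V)) :
    x ∈ X.basicOpen ((X.presheaf.map (homOfLE hWV).op).hom s) ↔ x ∈ X.basicOpen s := by
  rw [Scheme.basicOpen_res]
  exact ⟨fun h => h.2, fun h => ⟨hxW, h⟩⟩

/-- `x ∈ D(s|_W) ⟹ x ∈ D(s)`. [cite: StacksProject, Tag 01HR] -/
theorem mem_basicOpen_of_mem_basicOpen_res {W V : X.Opens} (hWV : W ≤ V) (s : Γ(X, V)) {x : X}
    (h : x ∈ X.basicOpen ((X.presheaf.map (homOfLE hWV).op).hom s)) : x ∈ X.basicOpen s := by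
  rw [Scheme.basicOpen_res] at h
  exact h.2

/-- `x ∈ D(s|_W) ⟹ x ∈ W`. [cite: StacksProject, Tag 01HR] -/
theorem mem_of_mem_basicOpen_res {W V : X.Opens} (hWV : W ≤ V) (s : Γ(X, V)) {x : X}
    (h : x ∈ X.basicOpen ((X.presheaf.map (homOfLE hWV).op).hom s)) : x ∈ W := by
  rw [Scheme.basicOpen_res] at h
  exact h.1

end Restrict


end Literature.AlgebraicGeometry.Morphisms

end
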